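import Summits.ResolutionOfSingularities.ResolutionOfSingularities.Theorems.EquisingularLiftEquisingularLiftNatTowerConeRound
import Summits.ResolutionOfSingularities.ResolutionOfSingularities.Theorems.EquisingularLiftEquisingularLiftNatStrictTransformsSeparate
import Literature.AlgebraicGeometry.Resolution.Blowups
import Summits.ResolutionOfSingularities.ResolutionOfSingularities.Theorems.EquisingularLiftEquisingularLiftNatEffectiveCartierSwap
import Literature.AlgebraicGeometry.Resolution.StrictTransformBaseChange
import Literature.AlgebraicGeometry.Resolution.BlowupStalkEmbedding
import HarnessLib

/-!
# [OURS · L1 W4.5(b) · EL♮(3)] HSUB′(ReachTower₂) — THE CONE-WITNESSED ROUND ON `Tower.Inv₂`, OLD EXCEPTIONAL SURFACE `E ↦ closure υ₂⁻¹(E ∖ Z)`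
# (tower driver clause (round), cone disjunct of `TowerRound₁/₂`, second conclusion; sequel of …NatTowerConeRound p558403)

res-D-pv-029 g8 (HSUB′(ReachTower)₃ ASSEMBLY). OURS; NOT a statement of any manuscript; AI-written, weaker than expert review. No `sorry`;
standard axioms. DEF-FREE. `--supports stmt-ResolutionOfSingularities-20148 --as helper`.

WHAT. `Tower.inv₂_coneRound_old`: in the setting of `Tower.inv₂_coneRound_new` (a cone-witnessed round `Z = E ∩ closure K` at a tower
stage with `Tower.Inv₂`), the TRANSPORTED OLD surface: `Tower.Inv₂` at `(G′, υ₂ ≫ γ, closure υ₂⁻¹(T ∖ Z), closure υ₂⁻¹(E ∖ Z), K′)` for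
both admitted shadows `K′ ∈ {∅, closure υ₂⁻¹(K ∖ Z)}`, modulo TWO stand-ins that are the content of the opaque ruled-surface parameter
`Ruled` (owner res-L1-w45b-stub-2 / res-type-027): `hEZ : E ⊆ closure (E ∖ Z)` (a full multisection is nowhere dense in a ruled surface:
the `ℙ¹`-fibres are infinite, `Z → Z̃₉` is finite) and `hRuled` (transport of the datum along the isomorphism `V(St 𝓔) ≅ V(𝓔)` over `τ`).
HOW. `𝓔″ := St_𝒞 𝓔` (`𝒞 = 𝓔 ⊔ 𝒦`): (e-i) res-D-pv-051 `coneRound_exceptional_comap` (its Cartier hypothesis `hK𝓔` is clause (k-vi) of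
`Tower.Shadow₂` — the reason (k-vi) is carried), (e-ii) res-type-032 `isPrincipal_stalkIdeal_strictTransformIdeal`, (e-iii) along
`exists_iso_subscheme_strictTransformIdeal_exceptional`, (e-iv) `St 𝓔 ≥ 𝓔·𝒪`; the shadow pair `(St 𝓔, St 𝒦)` is DISJOINT
(`strictTransformIdeal_sup_strictTransformIdeal_eq_top` p559007): (k-iii) the empty scheme is flat, (k-iv) vacuous, (k-v)/(k-vi) the
restrictions are the unit ideal (Literature `isEffectiveCartier_top`); (k-i)/(k-ii) as in the new-surface file.
-/

set_option linter.dupNamespace false -- mandated namespace `Summit.<Summit>.<Problem>` of this single-conjunct summit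
set_option linter.overlappingInstances false -- signatures carry `[IsDomain O] [IsDiscreteValuationRing O]`

noncomputable section

open CategoryTheory CategoryTheory.Limits AlgebraicGeometry TopologicalSpace Topology IsLocalRing
open Literature.AlgebraicGeometry.Resolution
open AlgebraicGeometry.Scheme.IdealSheafData
open Summit.ResolutionOfSingularities.ResolutionOfSingularities.Theses.EquisingularLift.Split
open Summit.ResolutionOfSingularities.ResolutionOfSingularities.Cruxes.EquisingularLift.StrataSplit

namespace Summit.ResolutionOfSingularities.ResolutionOfSingularities.Cruxes.EquisingularLiftNat.Sections

set_option maxHeartbeats 800000 in -- one large refine over a 20-clause invariant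
/-- **THE CONE-WITNESSED ROUND on `Tower.Inv₂`, transported OLD exceptional surface** (see the module docstring).
[cite: GortzWedhorn2020, (13.19) and Prop. 13.91] [cite: Liu2002, Thm. 8.1.19] [OURS · L1 W4.5b] clause (round) of the tower driver toward
`stub_elnat_coneTowerPointResolution`; NOT a statement of the manuscript. -/
theorem Tower.inv₂_coneRound_old (O : Type) [CommRing O] [IsDomain O] [IsDiscreteValuationRing O] (k : Type) [Field k]
    (θ : O →+* k) (hθ : Function.Surjective θ)
    (P : Scheme.{0}) (q : P ⟶ Spec (.of O)) [IsProper q] (Y : Set P) (hYirr : IsIrreducible Y) (hYcl : IsClosed Y)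
    (hPnoeth : IsLocallyNoetherian P) (hPreg : Scheme.IsRegular P)
    (Ch : ∀ X' : Scheme.{0}, (X' ⟶ P) → Set X' → Prop)
    (hChain : ∀ (X' : Scheme.{0}) (σ : X' ⟶ P) (S : Set X'), Ch X' σ S → Chain P Y X' σ S)
    (hStep : ∀ (X' X'' : Scheme.{0}) (σ' : X' ⟶ P) (S' : Set X') (C : X'.IdealSheafData) (τ : X'' ⟶ X'),
      Ch X' σ' S' → IsBlowup τ C → Scheme.IsRegular C.subscheme → Flat (C.subschemeι ≫ σ' ≫ q) →
      σ' '' (C.support : Set X') ⊆ {x : P | ¬ IsGenericPoint x Y} →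
      (C.support : Set X') ∩ (σ' ≫ q) ⁻¹' {IsLocalRing.closedPoint O} ⊆ S' →
      Ch X'' (τ ≫ σ') (closure (τ ⁻¹' (S' \ (C.support : Set X')))))
    (Ruled : Tower.RuledDatum P)
    {F₉ : Scheme.{0}} (Z₉ : Set F₉) (hZ₉ : IsClosed Z₉) {F₁₀ : Scheme.{0}} (υ' : F₁₀ ⟶ F₉)
    (G G' : Scheme.{0}) (γ : G ⟶ F₁₀) (T E K : Set G) (hE : IsClosed E) (Z : Set G) (hZ : IsClosed Z) (υ₂ : G' ⟶ G)
    (hinv : Tower.Inv₂ O k θ P q Y Ch Ruled F₉ Z₉ hZ₉ F₁₀ υ' G γ T E K)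
    (hZET : Z ⊆ E ∩ T) (hZne : Z.Nonempty) (hfull : TowerFull F₉ F₁₀ υ' Z₉ hZ₉ G γ Z hZ) (hcone : ConeWitness G E hE K Z hZ)
    (hυ₂ : IsBlowup υ₂ (vanishingIdeal ⟨Z, hZ⟩))
    -- the assembly's downstairs side facts carried next to `Tower.Inv₂`
    (hKcl : IsClosed K) (hKE : K ⊆ closure (K \ E))
    -- STAND-INS (owner res-L1-w45b-stub-2 / res-type-027; both are the content of `Ruled`): density of `E ∖ Z` in `E`, and the
    -- transport of the ruled-surface datum along the isomorphism `V(St 𝓔) ≅ V(𝓔)` over `τ`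
    (hEZ : E ⊆ closure (E \ Z))
    (hRuled : ∀ (X : Scheme.{0}) (σ : X ⟶ P) (jG : G ⟶ X) (𝓔 𝒦 : X.IdealSheafData) (X'' : Scheme.{0}) (τ : X'' ⟶ X)
        (j₂ : G' ⟶ X'') (t₂ : G' ⟶ Spec (.of k)),
        IsBlowup τ (𝓔 ⊔ 𝒦) → IsPullback j₂ t₂ ((τ ≫ σ) ≫ q) (Spec.map (CommRingCat.ofHom θ)) → j₂ ≫ τ = υ₂ ≫ jG →
        (𝓔 ⊔ 𝒦).comap jG = vanishingIdeal ⟨Z, hZ⟩ →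
        (∃ e : (strictTransformIdeal τ (𝓔 ⊔ 𝒦) 𝓔).subscheme ≅ 𝓔.subscheme,
          e.hom ≫ 𝓔.subschemeι = (strictTransformIdeal τ (𝓔 ⊔ 𝒦) 𝓔).subschemeι ≫ τ) →
        Ruled F₉ Z₉ hZ₉ F₁₀ υ' G γ E X σ jG 𝓔 →
        Ruled F₉ Z₉ hZ₉ F₁₀ υ' G' (υ₂ ≫ γ) (closure (υ₂ ⁻¹' (E \ Z))) X'' (τ ≫ σ) j₂ (strictTransformIdeal τ (𝓔 ⊔ 𝒦) 𝓔))
    (K' : Set G') (hK' : K' = ∅ ∨ K' = closure (υ₂ ⁻¹' (K \ Z))) :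
    Tower.Inv₂ O k θ P q Y Ch Ruled F₉ Z₉ hZ₉ F₁₀ υ' G' (υ₂ ≫ γ) (closure (υ₂ ⁻¹' (T \ Z))) (closure (υ₂ ⁻¹' (E \ Z))) K' := by
  classical
  obtain ⟨hυ', hZinf, hGint, hTcl, hTirr, hEcl, hTE₀, X, σ, S, jG, tG, hCh, hXint, hXnoeth, hXreg, hdom, hsq, hTS, hexc⟩ := hinv
  haveI := hGint
  haveI := hXint
  haveI := hXnoeth
  -- the exceptional surface hosts this round, so it is round-ready; the shadow is not forgotten
  have hZE : Z ⊆ E := fun z hz => (hZET hz).1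
  have hZT : Z ⊆ T := fun z hz => (hZET hz).2
  rcases hexc hE with hno | ⟨𝓔, he_i, he_ii, he_iii, he_iv, he_v, hshadow⟩
  · exact absurd hfull (Tower.not_towerFull_of_noRound υ' Z₉ hZ₉ hZinf G γ E hno Z hZ hZE)
  obtain ⟨hZeq, hwit⟩ := hcone
  rcases hshadow with hK0 | ⟨𝒦, hk_i, hk_ii, hk_iii, hk_iv, hk_v, hk_vi⟩
  · exfalso
    rw [hK0, closure_empty, Set.inter_empty] at hZeq
    exact hZne.ne_empty hZeq
  -- properness of the stage; the model square
  obtain ⟨-, -, hσ⟩ := chain_isRegular P Y X σ S (hChain _ _ _ hCh) hPnoeth hPreg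
  haveI := hσ
  haveI : IsProper (σ ≫ q) := inferInstance
  haveI : IsClosedImmersion (Spec.map (CommRingCat.ofHom θ)) := IsClosedImmersion.spec_of_surjective _ hθ
  haveI hjci : IsClosedImmersion jG := MorphismProperty.IsStableUnderBaseChange.of_isPullback hsq.flip inferInstance
  have hjsp : ∀ z : G, (σ ≫ q) (jG z) = closedPoint O := fun z => by
    have h1 : jG z ∈ Set.range jG := ⟨z, rfl⟩
    rw [range_eq_preimage_of_isPullback hsq, range_specMap_of_surjective_of_field θ hθ] at h1
    exact h1
  have hrangej : Set.range jG = (σ ≫ q) ⁻¹' {closedPoint O} := by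
    rw [range_eq_preimage_of_isPullback hsq, range_specMap_of_surjective_of_field θ hθ]
  -- the centre `𝒞 := 𝓔 ⊔ 𝒦`: exact trace `𝓘⟨Z⟩` (the cone witness), flat (k-iii), regular, off the generic point
  have hCD : (𝓔 ⊔ 𝒦).comap jG = vanishingIdeal ⟨Z, hZ⟩ := by
    rw [Scheme.IdealSheafData.comap_sup, he_i, hk_ii, hwit]
  have hZEK : (⟨E ∩ closure K, hE.inter isClosed_closure⟩ : Closeds G) = ⟨Z, hZ⟩ := Closeds.ext hZeq.symm
  have hCreg_pt : ∀ x ∈ ((𝓔 ⊔ 𝒦).support : Set X), (σ ≫ q) x = closedPoint O →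
      IsRegularLocalRing (X.presheaf.stalk x ⧸ stalkIdeal (𝓔 ⊔ 𝒦) x) := by
    intro x hx hqx
    obtain ⟨y, rfl⟩ : x ∈ Set.range jG := by rw [hrangej]; exact hqx
    refine hk_iv y hx ?_
    rw [hZEK, hwit]
  haveI : IsProper ((𝓔 ⊔ 𝒦).subschemeι ≫ σ ≫ q) := inferInstance
  have hCreg : Scheme.IsRegular (𝓔 ⊔ 𝒦).subscheme :=
    Scheme.isRegular_subscheme_of_forall_over_closedPoint (σ ≫ q) (𝓔 ⊔ 𝒦) fun x hx hqx => hCreg_pt x hx hqx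
  have hiv : σ '' ((𝓔 ⊔ 𝒦).support : Set X) ⊆ {p : P | ¬ IsGenericPoint p Y} := by
    rintro _ ⟨x, hx, rfl⟩
    exact he_iv ⟨x, Scheme.IdealSheafData.support_antitone le_sup_left hx, rfl⟩
  -- support bookkeeping downstairs
  have hsuppZ : ((vanishingIdeal ⟨Z, hZ⟩ : G.IdealSheafData).support : Set G) = Z := Scheme.IdealSheafData.coe_support_vanishingIdeal _
  have hDT : ((vanishingIdeal ⟨Z, hZ⟩ : G.IdealSheafData).support : Set G) ⊆ T := by rw [hsuppZ]; exact hZT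
  have hTZ : ¬ T ⊆ Z := fun h => hTE₀ (h.trans hZE)
  have hTD : ¬ T ⊆ ((vanishingIdeal ⟨Z, hZ⟩ : G.IdealSheafData).support : Set G) := by rw [hsuppZ]; exact hTZ
  -- blow up the centre and run the model step
  obtain ⟨X₂, τ, hτ⟩ := exists_isBlowup X (𝓔 ⊔ 𝒦)
  obtain ⟨hint₂, hnoeth₂, hreg₂, hdom₂, hF₂, hirr, j₂, t₂, hsq₂, hcomm, hCh₂⟩ :=
    modelStep_chain O k θ hθ P q Y hYirr hYcl Ch hChain hStep X σ S hCh hXreg hdom G jG tG hsq T hTS (𝓔 ⊔ 𝒦)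
      (vanishingIdeal ⟨Z, hZ⟩) hCD hCreg hk_iii hiv hDT hTD X₂ τ hτ G' υ₂ hυ₂
  rw [hsuppZ] at hirr hCh₂
  haveI := hint₂
  haveI := hnoeth₂
  haveI := hF₂
  haveI : IsProper τ := hτ.isProper
  have hcart : IsPullback j₂ υ₂ τ jG := isPullback_of_model_squares θ hθ (σ ≫ q) τ jG tG hsq j₂ t₂
    (by simpa only [Category.assoc] using hsq₂) υ₂ hcomm
  -- a point of `G'` off the exceptional surface, `T' ⊄ E'`, the centre is non-zero
  obtain ⟨t, htT, htE⟩ := Set.not_subset.mp hTE₀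
  have htZ : t ∉ Z := fun h => htE (hZE h)
  obtain ⟨t', ht'⟩ := hυ₂.exists_preimage_of_not_mem_support (z := t) (by rw [hsuppZ]; exact htZ)
  have hTE : ¬ closure (υ₂ ⁻¹' (T \ Z)) ⊆ υ₂ ⁻¹' Z := by
    intro h
    have h1 : t' ∈ closure (υ₂ ⁻¹' (T \ Z)) := subset_closure (show υ₂ t' ∈ T \ Z by rw [ht']; exact ⟨htT, htZ⟩)
    have h2 : υ₂ t' ∈ Z := h h1
    rw [ht'] at h2
    exact htZ h2
  have hCne : 𝓔 ⊔ 𝒦 ≠ ⊥ := by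
    rintro hbot
    obtain ⟨u, hu, hKu⟩ := hτ.isEffectiveCartier.exists_stalkIdeal_eq_span (j₂ t')
    rw [hbot, Scheme.IdealSheafData.comap_bot, stalkIdeal_bot, eq_comm, Ideal.span_singleton_eq_bot] at hKu
    rw [hKu] at hu
    exact zero_notMem_nonZeroDivisors hu
  -- `T' ⊄ E''`: the point `t'` over `t ∈ T ∖ E`
  have hTE'' : ¬ closure (υ₂ ⁻¹' (T \ Z)) ⊆ closure (υ₂ ⁻¹' (E \ Z)) := by
    intro h
    have h1 : t' ∈ closure (υ₂ ⁻¹' (T \ Z)) := subset_closure (show υ₂ t' ∈ T \ Z by rw [ht']; exact ⟨htT, htZ⟩)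
    have h2 : t' ∈ υ₂ ⁻¹' E :=
      (closure_minimal (Set.preimage_mono fun x hx => hx.1) (hE.preimage υ₂.continuous)) (h h1)
    rw [Set.mem_preimage, ht'] at h2
    exact htE h2
  -- the transported old surface `𝓔'' := St_𝒞 𝓔`
  have hEc : ((⟨E, hE⟩ : Closeds G) : Set G) ⊆ closure (((⟨E, hE⟩ : Closeds G) : Set G) \ (⟨Z, hZ⟩ : Closeds G)) := hEZ
  have ho1 : (strictTransformIdeal τ (𝓔 ⊔ 𝒦) 𝓔).comap j₂ =
      vanishingIdeal (⟨closure (υ₂ ⁻¹' (E \ Z)), isClosed_closure⟩ : Closeds G') :=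
    coneRound_exceptional_comap 𝓔 𝒦 hk_vi hτ hcart ⟨E, hE⟩ ⟨Z, hZ⟩ he_i hυ₂ hEc
  have ho2 : ∀ z : X₂, (stalkIdeal (strictTransformIdeal τ (𝓔 ⊔ 𝒦) 𝓔) z).IsPrincipal := fun z =>
    isPrincipal_stalkIdeal_strictTransformIdeal hXreg hCreg hτ hCne 𝓔 he_ii z
  obtain ⟨e𝓔, he𝓔⟩ := exists_iso_subscheme_strictTransformIdeal_exceptional 𝓔 𝒦 hk_vi hτ
  have ho3 : Scheme.IsRegular (strictTransformIdeal τ (𝓔 ⊔ 𝒦) 𝓔).subscheme :=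
    Scheme.IsRegular.of_isOpenImmersion e𝓔.hom he_iii
  have ho4 : (τ ≫ σ) '' ((strictTransformIdeal τ (𝓔 ⊔ 𝒦) 𝓔).support : Set X₂) ⊆ {p : P | ¬ IsGenericPoint p Y} := by
    rintro _ ⟨z, hz, rfl⟩
    have hz' : z ∈ ((𝓔.comap τ).support : Set X₂) :=
      Scheme.IdealSheafData.support_antitone (comap_le_strictTransformIdeal τ (𝓔 ⊔ 𝒦) 𝓔) hz
    rw [Scheme.IdealSheafData.support_comap] at hz'
    exact he_iv ⟨τ z, hz', rfl⟩
  -- the shadow pair `(St 𝓔, St 𝒦)` is disjoint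
  have hsep : strictTransformIdeal τ (𝓔 ⊔ 𝒦) 𝓔 ⊔ strictTransformIdeal τ (𝓔 ⊔ 𝒦) 𝒦 = ⊤ :=
    strictTransformIdeal_sup_strictTransformIdeal_eq_top τ 𝓔 𝒦 hτ he_ii hk_i
  have hk1 : ∀ z : X₂, (stalkIdeal (strictTransformIdeal τ (𝓔 ⊔ 𝒦) 𝒦) z).IsPrincipal := fun z =>
    isPrincipal_stalkIdeal_strictTransformIdeal hXreg hCreg hτ hCne 𝒦 hk_i z
  have hKc : K = closure K := hKcl.closure_eq.symm
  have hk2 : (strictTransformIdeal τ (𝓔 ⊔ 𝒦) 𝒦).comap j₂ =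
      vanishingIdeal (⟨closure (closure (υ₂ ⁻¹' (K \ Z))), isClosed_closure⟩ : Closeds G') := by
    have hdense : ((⟨closure K, isClosed_closure⟩ : Closeds G) : Set G) ⊆
        closure (((⟨closure K, isClosed_closure⟩ : Closeds G) : Set G) \ (⟨Z, hZ⟩ : Closeds G)) := by
      change closure K ⊆ closure (closure K \ Z)
      rw [← hKc]
      exact hKE.trans (closure_mono fun x hx => ⟨hx.1, fun hxZ => hx.2 (hZE hxZ)⟩)
    have h := coneRound_shadow_comap 𝓔 𝒦 hk_v hτ hcart ⟨closure K, isClosed_closure⟩ ⟨Z, hZ⟩ hk_ii hυ₂ hdense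
    rw [h]
    congr 1
    refine Closeds.ext ?_
    change closure (υ₂ ⁻¹' (closure K \ Z)) = closure (closure (υ₂ ⁻¹' (K \ Z)))
    rw [closure_closure, ← hKc]
  haveI hempty : IsEmpty (strictTransformIdeal τ (𝓔 ⊔ 𝒦) 𝓔 ⊔ strictTransformIdeal τ (𝓔 ⊔ 𝒦) 𝒦).subscheme := by
    rw [← (Scheme.IdealSheafData.subschemeι _).ker_eq_top_iff_isEmpty, Scheme.IdealSheafData.ker_subschemeι]
    exact hsep
  have hk3 : Flat ((strictTransformIdeal τ (𝓔 ⊔ 𝒦) 𝓔 ⊔ strictTransformIdeal τ (𝓔 ⊔ 𝒦) 𝒦).subschemeι ≫ (τ ≫ σ) ≫ q) :=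
    inferInstance
  have hk4 : ∀ (E' : Set G') (hE' : IsClosed E') (K'' : Set G') (y : G'),
      j₂ y ∈ ((strictTransformIdeal τ (𝓔 ⊔ 𝒦) 𝓔 ⊔ strictTransformIdeal τ (𝓔 ⊔ 𝒦) 𝒦).support : Set X₂) →
      stalkIdeal (vanishingIdeal (⟨E', hE'⟩ : Closeds G') ⊔
        vanishingIdeal (⟨closure K'', isClosed_closure⟩ : Closeds G')) y =
      stalkIdeal (vanishingIdeal (⟨E' ∩ closure K'', hE'.inter isClosed_closure⟩ : Closeds G')) y →
      IsRegularLocalRing (X₂.presheaf.stalk (j₂ y) ⧸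
        stalkIdeal (strictTransformIdeal τ (𝓔 ⊔ 𝒦) 𝓔 ⊔ strictTransformIdeal τ (𝓔 ⊔ 𝒦) 𝒦) (j₂ y)) := by
    intro E' hE' K'' y hy _
    rw [hsep, Scheme.IdealSheafData.support_top] at hy
    exact absurd hy (by simp)
  have hcomap_top : ∀ (I J : X₂.IdealSheafData), I ⊔ J = ⊤ → I.comap J.subschemeι = ⊤ := by
    intro I J hIJ
    rw [← Scheme.IdealSheafData.support_eq_bot_iff, eq_bot_iff]
    intro s hs
    rw [Scheme.IdealSheafData.support_comap] at hs
    have h1 : J.subschemeι s ∈ (J.support : Set X₂) := by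
      rw [← Scheme.IdealSheafData.range_subschemeι]; exact ⟨s, rfl⟩
    have h2 : J.subschemeι s ∈ ((I ⊔ J).support : Set X₂) := by
      rw [Scheme.IdealSheafData.support_sup]; exact ⟨hs, h1⟩
    rw [hIJ, Scheme.IdealSheafData.support_top] at h2
    exact absurd h2 (by simp)
  have hk5 : IsEffectiveCartier ((strictTransformIdeal τ (𝓔 ⊔ 𝒦) 𝓔).comap (strictTransformIdeal τ (𝓔 ⊔ 𝒦) 𝒦).subschemeι) := by
    rw [hcomap_top _ _ hsep]; exact isEffectiveCartier_top
  have hk6 : IsEffectiveCartier ((strictTransformIdeal τ (𝓔 ⊔ 𝒦) 𝒦).comap (strictTransformIdeal τ (𝓔 ⊔ 𝒦) 𝓔).subschemeι) := by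
    rw [hcomap_top _ _ (by rw [sup_comm]; exact hsep)]; exact isEffectiveCartier_top
  -- assemble
  refine ⟨hυ', hZinf, hF₂, isClosed_closure, hirr, isClosed_closure, hTE'', X₂, τ ≫ σ, _, j₂, t₂, hCh₂, hint₂, hnoeth₂,
    hreg₂, hdom₂, hsq₂, rfl, fun hE' => Or.inr ⟨strictTransformIdeal τ (𝓔 ⊔ 𝒦) 𝓔, ho1, ho2, ho3, ho4, ?_, ?_⟩⟩
  · exact hRuled X σ jG 𝓔 𝒦 X₂ τ j₂ t₂ hτ hsq₂ hcomm hCD ⟨e𝓔, he𝓔⟩ he_v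
  · rcases hK' with hK' | hK'
    · exact Or.inl hK'
    · subst hK'
      exact Or.inr ⟨_, hk1, hk2, hk3, hk4 _ _ _, hk5, hk6⟩

end Summit.ResolutionOfSingularities.ResolutionOfSingularities.Cruxes.EquisingularLiftNat.Sections

end
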